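import Mathlib.AlgebraicGeometry.Restrict
import HarnessLib

/-!
# Points and stalks of the source of a restricted morphism

Support file for crux stmt-ResolutionOfSingularities-15315
(`FrobeniusLadder.FInjectiveMacaulayfication`, line `Sketch`, lead seat c6, cycle 7, wave 3):
stub `stub_restrictStalkIso` (surgery glue piece).

The surgery glue of the F-injective Macaulayfication line restricts a blow-up `π : X' ⟶ X₁` over
an open `U ∋ b` of the base, `π ∣_ U : ↑(π ⁻¹ᵁ U) ⟶ ↑U` (Mathlib's `morphismRestrict`), and has
to move points and stalks between the open subscheme `↑(π ⁻¹ᵁ U)` and `X'`. This is pure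
bookkeeping over `Mathlib.AlgebraicGeometry.Restrict`:

* the point equation `((f ∣_ U) x).1 = f x.1` is `morphismRestrict_base_coe` (the restriction
  commutes with the open immersions `(f ⁻¹ᵁ U).ι` and `U.ι`, `morphismRestrict_ι`);
* the stalk of the open subscheme `↑(f ⁻¹ᵁ U)` at `x` is the stalk of `X` at `x.1`: the
  isomorphism `Scheme.Opens.stalkIso (f ⁻¹ᵁ U) x` (the inverse of the stalk map of the open
  immersion `(f ⁻¹ᵁ U).ι`, `Scheme.Opens.stalkIso_inv`), turned into a ring isomorphism.

References: folklore bookkeeping over Mathlib's `AlgebraicGeometry.morphismRestrict` and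
`AlgebraicGeometry.Scheme.Opens.stalkIso`; no definition is declared. [folklore]
-/

-- single-problem summit: the doubled namespace component `ResolutionOfSingularities` is forced
set_option linter.dupNamespace false

noncomputable section

namespace Summit.ResolutionOfSingularities.ResolutionOfSingularities.Theorems.FInjectiveMacaulayfication.RestrictStalkIso

open AlgebraicGeometry CategoryTheory

/-- **Points and stalks of the source of a restricted morphism** (registered stub
`stub_restrictStalkIso`). For a morphism of schemes `f : X ⟶ Y`, an open `U` of `Y` and a point
`x` of the open subscheme `↑(f ⁻¹ᵁ U)`, the restriction `f ∣_ U : ↑(f ⁻¹ᵁ U) ⟶ ↑U` sends `x` to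
the point of `↑U` lying over `f x.1`, and the stalk of `↑(f ⁻¹ᵁ U)` at `x` is ring-isomorphic to
the stalk of `X` at `x.1` (open subschemes have the same stalks, `Scheme.Opens.stalkIso`).
[folklore] -/
theorem stub_restrictStalkIso : ∀ (X Y : Scheme.{0}) (f : X ⟶ Y) (U : Y.Opens) (x : ↥(f ⁻¹ᵁ U)),
    ((f ∣_ U).base x).1 = f.base x.1 ∧
      Nonempty ((↑(f ⁻¹ᵁ U) : Scheme.{0}).presheaf.stalk x ≃+* X.presheaf.stalk x.1) :=
  fun _ _ f U x =>
    ⟨morphismRestrict_base_coe f U x, ⟨((f ⁻¹ᵁ U).stalkIso x).commRingCatIsoToRingEquiv⟩⟩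

end Summit.ResolutionOfSingularities.ResolutionOfSingularities.Theorems.FInjectiveMacaulayfication.RestrictStalkIso

end
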